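import Summits.BirchSwinnertonDyer.BirchSwinnertonDyer.Theorems.CyclotomicUntwistInertiaOverCyclotomicNine
import Summits.BirchSwinnertonDyer.BirchSwinnertonDyer.Theorems.CyclotomicUntwistPSKodairaDictionary
import Summits.BirchSwinnertonDyer.Rank1Residual.Additive.UnramifiedBaseChange
import Literature.NumberTheory.EllipticCurves.OggFormulaWildThreeProofs
import Literature.NumberTheory.EllipticCurves.TateModuleWildKernelProofs
import Literature.NumberTheory.EllipticCurves.TateModuleUnipotentInertiaProofs
import Literature.NumberTheory.DiophantineGeometry.ConductorRingOfIntegersProofs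
import Literature.NumberTheory.DiophantineGeometry.ConductorTameWildProofs
import Literature.NumberTheory.DiophantineGeometry.TateAlgorithmAdditiveProofs
import Literature.NumberTheory.GaloisRepresentations.RamificationFiltrationProofs
import Literature.NumberTheory.GaloisRepresentations.ModPGaloisRepProofs
import HarnessLib

/-!
# The Swan conductor of `V_ℓ(W)` at `3` on the wild cell (class O6) and on the principal-series rows:
# `Sw_𝔓(V_ℓ W) = f₃(W) − 2 ∈ {1, 2, 3}`, `= 2` exactly on the cyclic (principal-series) rows — a SECOND,
# Swan-conductor road to the Galois wildness of the registered stub `stub_WILD`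

Cell `pub/bsd-wall` (D-0145 line `route-BirchSwinnertonDyer-CyclotomicUntwist`), seat `bsd-line-cycu-p4` (width
seat 4, gen 13). THEOREMS ONLY (no definition, no named fact, no `sorry`; standard axioms); helper `--supports`
the crux K1 stmt-BirchSwinnertonDyer-21580 (`PSRankOneLowerHalfAtThree`; the same rows carry K2 21581 and the
residual item 21582). BSD is not proved by this file; no crux and no child of the route is proved by it (K1/K2
stay OPEN and WHOLE: research stubs C4/C5 + print; C1 stays print-conditional).

WHAT (every arithmetic input a theorem of the tree; NO modularity, NO newform, NO named print fact).
* §1 On EVERY class-O6 row at `3` (`ClassO6 W 3`: additive, `ord₃ j ≥ 0`, `f₃ ≠ 2` — the whole wild cell,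
  principal-series AND supercuspidal rows) and every prime `ℓ ≠ 3`, at every prime `𝔓 ∣ 3` of `ℤ̄`:
  **`Sw_𝔓(V_ℓ W) = f₃(W) − 2`** (`swanConductorAt_rationalTate_eq_condExp_sub_two_of_classO6`), hence
  `1 ≤ Sw_𝔓(V_ℓ W) ≤ 3`, `V_ℓ W` is NOT tame at `𝔓` and some element of a wild ramification group `Γ_ℚ^u(𝔓)`,
  `u > 0`, moves an `ℓ`-power torsion point of `W(ℚ̄)` (`exists_wild_smul_torsion_ne_of_classO6`). Inputs:
  Ogg's formula at `3` — a THEOREM of the tree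
  (`WeierstrassCurve.swanConductorAt_rationalTate_eq_wildConductorExponent_of_ringChar_eq_three_holds`,
  `OggFormulaWildThreeProofs`, Silverman *ATAEC* IV.11.1 for `p = 3`), `f = ε + δ` with `ε = 2` at an additive
  place (`ConductorTameWildProofs`, `TateAlgorithmAdditiveProofs`), the `𝓞 ℚ`/`ℤ` bridge for `f`
  (`conductorExponent_ringOfIntegers_eq`), `3 ≤ f₃ ≤ 5` on the wild cell (`KodairaCondExpThree`,
  `PSKodairaDictionary.condExp_three_le_five`), and `Sw = 0 ↔ tame` (`TateModuleWildKernelProofs`).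
* §2 On the CYCLIC rows (`v₃(Δ_min)` even — the route's principal-series rows) `Sw_𝔓(V_ℓ W) = 2` EXACTLY
  (`f₃ = 4`, `PSKodairaDictionary.condExp_eq_four_iff_even`); on the DICYCLIC rows (`v₃(Δ_min)` odd — the residual
  item `WildSurjRankOneSupercuspidalAtThree`) `Sw_𝔓(V_ℓ W) ∈ {1, 3}` is ODD. The `ℓ`-adic shadow of
  «principal series `PS(χ, χ⁻¹)`, `a(χ) = 2`, `f₃ = 2 + 2`» versus «supercuspidal, `f₃ ∈ {3, 5}`».
* §3 Wild elements at `3` and the mod-`9` cyclotomic character: for `σ ∈ Γ_ℚ^u(𝔓)`, `u > 0`, `𝔓 ∣ 3`: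
  `χ₉(σ)³ = 1`, i.e. `χ₉(σ) ∈ {1, 4, 7}` (the restriction of `σ` to a finite Galois `E ∋ ζ₉` lies in
  `Gal(E/ℚ)^u ≤ G₁`, a `3`-group — `isPGroup_ramificationSubgroup_one_of_mem_primesAbove`).
* §4 On the principal-series rows (`ClassO6`, `v₃(Δ_min)` even, unit part `≡ 1 (mod 3)`), for EVERY `τ ∈ I_𝔓`
  with `χ₉(τ) = 2`: **`ρ_ℓ(τ)² ≠ 1`** (`rationalGaloisRepTate_sq_ne_one_of_psRow`) — by §1–§3 and the lead's
  `InertiaOverCyclotomicNine` (an inertia element fixing `ζ₉` acts trivially): `ρ(τ)² = 1` would make every wild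
  element (`χ₉ ∈ {4⁰, 4¹, 4²}`) act as a power of `ρ(τ²) = 1`, i.e. `V_ℓ W` tame at `𝔓`, against §1. This is a
  second, independent road (Swan conductor / Ogg) to the content of the registered stub `stub_WILD` of the
  skeletons v7 of K1/K2, landed print-free by cycu-p5 g15 as
  `InertiaWildAtThreeUnconditional.stub_WILD_unconditional` (Néron–Ogg–Shafarevich over `ℚ(ζ₃)`); the stub is
  NOT re-declared here.

References: [cite: SilvermanATAEC1994, Thm. IV.11.1 (Ogg's formula, p = 3, PDF pp. 366–371) and §IV.10] ·
[cite: Ogg1967] · [cite: SerreLocalFields1979, Ch. IV §2 Cor. 3 of Prop. 7, §3 Remark 1; Ch. VI §2] ·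
[cite: Kraus1990, Théorème 1 (p = 3)] · [cite: SilvermanAEC2009, Prop. VII.4.1].
-/

set_option autoImplicit false
-- single-conjunct summit: `Summit.BirchSwinnertonDyer.BirchSwinnertonDyer.…` repeats the name by design
set_option linter.dupNamespace false

noncomputable section

open scoped NumberField IntermediateField
open WeierstrassCurve (geomPoints)
open NumberField IsDedekindDomain Field Rat.HeightOneSpectrum
  Literature.NumberTheory.GaloisRepresentations Literature.NumberTheory.EllipticCurves
  Literature.NumberTheory.EllipticCurves.Rank1Residual
  Literature.NumberTheory.DiophantineGeometry
  Summit.BirchSwinnertonDyer.Rank1Residual.Additive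
  Summit.BirchSwinnertonDyer.BirchSwinnertonDyer.Theorems.InertiaOverCyclotomicNine

namespace Summit.BirchSwinnertonDyer.BirchSwinnertonDyer.Theorems.SwanConductorAtThree

/-! ### §0 Bookkeeping at the place of `ℚ` above `3` -/

/-- The tame part of the conductor exponent of an ADDITIVE Kodaira type is `2`. [folklore] -/
theorem tameConductorExponent_eq_two_of_isAdditive {k : KodairaSymbol} (hk : k.IsAdditive) :
    k.tameConductorExponent = 2 := by
  have h2 := k.tameConductorExponent_le_two
  have h0 : k.tameConductorExponent ≠ 0 := fun h ↦ hk.1 (k.tameConductorExponent_eq_zero_iff.mp h)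
  have h1 : k.tameConductorExponent ≠ 1 := fun h ↦ hk.2 (k.tameConductorExponent_eq_one_iff.mp h)
  omega

/-- A place `v ∋ 3` of `ℚ` is THE place above `3`: `primesEquiv v = 3`. [folklore] -/
theorem primesEquiv_eq_three {v : HeightOneSpectrum (𝓞 ℚ)} (hv : (3 : 𝓞 ℚ) ∈ v.asIdeal) :
    primesEquiv v = ⟨3, Nat.prime_three⟩ :=
  Subtype.ext (natGenerator_eq_three hv)

/-- At a place `v ∋ 3` of `ℚ` the residue characteristic is `3`. [folklore] -/
theorem ringChar_eq_three {v : HeightOneSpectrum (𝓞 ℚ)} (hv : (3 : 𝓞 ℚ) ∈ v.asIdeal) :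
    ringChar (𝓞 ℚ ⧸ v.asIdeal) = 3 := by
  by_contra hne
  exact v.natCast_notMem_of_ringChar_ne Nat.prime_three hne (by exact_mod_cast hv)

/-- At a place `v ∋ 3` of `ℚ`, `2 ∉ v`. [folklore] -/
theorem two_notMem {v : HeightOneSpectrum (𝓞 ℚ)} (hv : (3 : 𝓞 ℚ) ∈ v.asIdeal) :
    ((2 : ℕ) : 𝓞 ℚ) ∉ v.asIdeal :=
  v.natCast_notMem_of_ringChar_ne Nat.prime_two (by rw [ringChar_eq_three hv]; decide)

/-- The `𝓞 ℚ` / `ℤ` bridge for the conductor exponent at `3`: `f_v = condExp W 3` for `v ∋ 3`. [folklore] -/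
theorem conductorExponent_eq_condExp_three (W : WeierstrassCurve ℚ) [W.IsElliptic]
    {v : HeightOneSpectrum (𝓞 ℚ)} (hv : (3 : 𝓞 ℚ) ∈ v.asIdeal) :
    W.conductorExponent v = condExp W 3 := by
  haveI : Fact (Nat.Prime 3) := ⟨Nat.prime_three⟩
  rw [W.conductorExponent_ringOfIntegers_eq v, primesEquiv_eq_three hv]
  rfl

/-- Additive reduction at a place `v ∋ 3` of `ℚ` from the census bit `Addv W 3`. [folklore] -/
theorem hasAdditiveReductionAt_of_addv_three (W : WeierstrassCurve ℚ) [W.IsElliptic]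
    {v : HeightOneSpectrum (𝓞 ℚ)} (hv : (3 : 𝓞 ℚ) ∈ v.asIdeal) (hadd : Addv W 3) :
    W.HasAdditiveReductionAt v := by
  haveI : Fact (Nat.Prime 3) := ⟨Nat.prime_three⟩
  have hv' : v = (primesEquiv (R := 𝓞 ℚ)).symm ⟨3, Nat.prime_three⟩ := by
    rw [← primesEquiv_eq_three hv, Equiv.symm_apply_apply]
  rw [hv']
  exact hasAdditiveReductionAt_of_addv W 3 hadd

/-! ### §1 The Swan conductor of `V_ℓ(W)` at `3` on class O6 -/

section ClassO6

variable (W : WeierstrassCurve ℚ) [W.IsElliptic] (ℓ : ℕ) [Fact ℓ.Prime]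

/-- The wild part of the conductor at a place `v ∋ 3` on class O6 is `f₃ − 2`. [folklore] -/
theorem wildConductorExponent_eq_condExp_sub_two_of_classO6 (hO6 : ClassO6 W 3)
    {v : HeightOneSpectrum (𝓞 ℚ)} (hv : (3 : 𝓞 ℚ) ∈ v.asIdeal) :
    W.wildConductorExponent v = condExp W 3 - 2 := by
  haveI : PerfectField (IsLocalRing.ResidueField (v.adicCompletionIntegers ℚ)) := PerfectField.ofFinite
  have hadd : (W.kodairaSymbolAt v).IsAdditive :=
    (W.isAdditive_kodairaSymbolAt_iff_holds v).mpr (hasAdditiveReductionAt_of_addv_three W hv hO6.2.1)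
  rw [WeierstrassCurve.wildConductorExponent, tameConductorExponent_eq_two_of_isAdditive hadd,
    conductorExponent_eq_condExp_three W hv]

/-- **Ogg's formula on class O6, read on the census bit `f₃`**: for every `ℓ ≠ 3` and every prime `𝔓 ∣ 3`
of `ℤ̄`, `Sw_𝔓(V_ℓ W) = f₃(W) − 2`. [cite: SilvermanATAEC1994, Thm. IV.11.1 (p = 3)] -/
theorem swanConductorAt_rationalTate_eq_condExp_sub_two_of_classO6 (hO6 : ClassO6 W 3) (hℓ : ℓ ≠ 3)
    (h : Continuous fun x : absoluteGaloisGroup ℚ × RationalTateModule (geomPoints W) ℓ ↦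
      rationalTateRepresentation (absoluteGaloisGroup ℚ) (geomPoints W) ℓ x.1 x.2)
    {v : HeightOneSpectrum (𝓞 ℚ)} (hv : (3 : 𝓞 ℚ) ∈ v.asIdeal)
    {𝔓 : Ideal (absIntegers (𝓞 ℚ) ℚ)} (h𝔓 : 𝔓 ∈ v.primesAbove) :
    (rationalTateGaloisRepOf (geomPoints W) ℓ h).swanConductorAt (𝓞 ℚ) 𝔓 = (condExp W 3 : ℝ) - 2 := by
  have hℓv : (ℓ : 𝓞 ℚ) ∉ v.asIdeal :=
    v.natCast_notMem_of_ringChar_ne Fact.out (by rw [ringChar_eq_three hv]; exact Ne.symm hℓ)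
  rw [W.swanConductorAt_rationalTate_eq_wildConductorExponent_of_ringChar_eq_three_holds ℓ h v hℓv
    (hasAdditiveReductionAt_of_addv_three W hv hO6.2.1) (ringChar_eq_three hv) h𝔓,
    wildConductorExponent_eq_condExp_sub_two_of_classO6 W hO6 hv]
  have h3 : 3 ≤ condExp W 3 :=
    three_le_condExp_three_of_kodairaSymbolAt_wild W ((subW_three_iff_kodairaSymbolAt_wild W hO6.2.1).mp hO6.2.2)
  rw [Nat.cast_sub (by omega)]
  norm_num

/-- **`1 ≤ Sw_𝔓(V_ℓ W) ≤ 3` on class O6** (`3 ≤ f₃ ≤ 5`). [cite: SilvermanATAEC1994, Thm. IV.11.1 and IV.10.4] -/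
theorem one_le_swanConductorAt_rationalTate_of_classO6 (hO6 : ClassO6 W 3) (hℓ : ℓ ≠ 3)
    (h : Continuous fun x : absoluteGaloisGroup ℚ × RationalTateModule (geomPoints W) ℓ ↦
      rationalTateRepresentation (absoluteGaloisGroup ℚ) (geomPoints W) ℓ x.1 x.2)
    {v : HeightOneSpectrum (𝓞 ℚ)} (hv : (3 : 𝓞 ℚ) ∈ v.asIdeal)
    {𝔓 : Ideal (absIntegers (𝓞 ℚ) ℚ)} (h𝔓 : 𝔓 ∈ v.primesAbove) :
    1 ≤ (rationalTateGaloisRepOf (geomPoints W) ℓ h).swanConductorAt (𝓞 ℚ) 𝔓 ∧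
      (rationalTateGaloisRepOf (geomPoints W) ℓ h).swanConductorAt (𝓞 ℚ) 𝔓 ≤ 3 := by
  rw [swanConductorAt_rationalTate_eq_condExp_sub_two_of_classO6 W ℓ hO6 hℓ h hv h𝔓]
  have h3 : 3 ≤ condExp W 3 :=
    three_le_condExp_three_of_kodairaSymbolAt_wild W ((subW_three_iff_kodairaSymbolAt_wild W hO6.2.1).mp hO6.2.2)
  have h5 : condExp W 3 ≤ 5 := PSKodairaDictionary.condExp_three_le_five W
  have h3' : (3 : ℝ) ≤ condExp W 3 := by exact_mod_cast h3
  have h5' : (condExp W 3 : ℝ) ≤ 5 := by exact_mod_cast h5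
  constructor <;> linarith

/-- **`V_ℓ W` is NOT tame at `3` on class O6** (`ℓ ≠ 3`). [cite: SilvermanATAEC1994, Thm. IV.11.1 (p = 3)] -/
theorem not_isTameAt_rationalTate_of_classO6 (hO6 : ClassO6 W 3) (hℓ : ℓ ≠ 3)
    (h : Continuous fun x : absoluteGaloisGroup ℚ × RationalTateModule (geomPoints W) ℓ ↦
      rationalTateRepresentation (absoluteGaloisGroup ℚ) (geomPoints W) ℓ x.1 x.2)
    {v : HeightOneSpectrum (𝓞 ℚ)} (hv : (3 : 𝓞 ℚ) ∈ v.asIdeal)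
    {𝔓 : Ideal (absIntegers (𝓞 ℚ) ℚ)} (h𝔓 : 𝔓 ∈ v.primesAbove) :
    ¬ (rationalTateGaloisRepOf (geomPoints W) ℓ h).IsTameAt (𝓞 ℚ) 𝔓 := by
  intro ht
  have h0 := ht.swanConductorAt_eq_zero
  have h1 := (one_le_swanConductorAt_rationalTate_of_classO6 W ℓ hO6 hℓ h hv h𝔓).1
  linarith

/-- **On class O6 some WILD element at `3` moves an `ℓ`-power torsion point** (`ℓ ≠ 3`): there are `u > 0`,
`σ ∈ Γ_ℚ^u(𝔓)` and `P ∈ W(ℚ̄)` with `ℓⁿ P = 0` and `σ P ≠ P`. [cite: SilvermanATAEC1994, Thm. IV.11.1 and Lemma IV.10.1(d)] -/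
theorem exists_wild_smul_torsion_ne_of_classO6 (hO6 : ClassO6 W 3) (hℓ : ℓ ≠ 3)
    {v : HeightOneSpectrum (𝓞 ℚ)} (hv : (3 : 𝓞 ℚ) ∈ v.asIdeal)
    {𝔓 : Ideal (absIntegers (𝓞 ℚ) ℚ)} (h𝔓 : 𝔓 ∈ v.primesAbove) :
    ∃ u : ℝ, 0 < u ∧ ∃ σ ∈ absUpperRamificationSubgroup (𝓞 ℚ) 𝔓 u,
      ∃ (n : ℕ) (P : geomPoints W), ℓ ^ n • P = 0 ∧ σ • P ≠ P := by
  have h := W.continuous_rationalGaloisRepTate_holds ℓ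
  have hℓv : (ℓ : 𝓞 ℚ) ∉ v.asIdeal :=
    v.natCast_notMem_of_ringChar_ne Fact.out (by rw [ringChar_eq_three hv]; exact Ne.symm hℓ)
  refine (W.swanConductorAt_rationalTate_ne_zero_iff_exists_smul_ne ℓ h hℓv h𝔓).mp ?_
  have h1 := (one_le_swanConductorAt_rationalTate_of_classO6 W ℓ hO6 hℓ h hv h𝔓).1
  intro h0
  rw [h0] at h1
  exact absurd h1 (by norm_num)

/-! ### §2 The cyclic (principal-series) rows: `Sw = 2`; the dicyclic rows: `Sw ∈ {1, 3}` -/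

/-- **On the cyclic rows of the wild cell (`v₃(Δ_min)` even — the principal-series rows of the route)
`Sw_𝔓(V_ℓ W) = 2` exactly** (`f₃ = 4`). [cite: Kraus1990, Théorème 1 (p = 3)] [cite: SilvermanATAEC1994, Thm. IV.11.1] -/
theorem swanConductorAt_rationalTate_eq_two_of_even [W.IsGloballyMinimal] (hO6 : ClassO6 W 3)
    (hev : Even (padicValInt 3 W.minimalDiscriminantInt)) (hℓ : ℓ ≠ 3)
    (h : Continuous fun x : absoluteGaloisGroup ℚ × RationalTateModule (geomPoints W) ℓ ↦
      rationalTateRepresentation (absoluteGaloisGroup ℚ) (geomPoints W) ℓ x.1 x.2)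
    {v : HeightOneSpectrum (𝓞 ℚ)} (hv : (3 : 𝓞 ℚ) ∈ v.asIdeal)
    {𝔓 : Ideal (absIntegers (𝓞 ℚ) ℚ)} (h𝔓 : 𝔓 ∈ v.primesAbove) :
    (rationalTateGaloisRepOf (geomPoints W) ℓ h).swanConductorAt (𝓞 ℚ) 𝔓 = 2 := by
  rw [swanConductorAt_rationalTate_eq_condExp_sub_two_of_classO6 W ℓ hO6 hℓ h hv h𝔓,
    (PSKodairaDictionary.condExp_eq_four_iff_even W hO6.2.1 hO6.2.2).mpr hev]
  norm_num

/-- **On the dicyclic rows (`v₃(Δ_min)` odd — the residual supercuspidal rows) `Sw_𝔓(V_ℓ W) ∈ {1, 3}`**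
(`f₃ ∈ {3, 5}`). [cite: Kraus1990, Théorème 1 (p = 3)] [cite: SilvermanATAEC1994, Thm. IV.11.1] -/
theorem swanConductorAt_rationalTate_eq_one_or_three_of_odd [W.IsGloballyMinimal] (hO6 : ClassO6 W 3)
    (hodd : Odd (padicValInt 3 W.minimalDiscriminantInt)) (hℓ : ℓ ≠ 3)
    (h : Continuous fun x : absoluteGaloisGroup ℚ × RationalTateModule (geomPoints W) ℓ ↦
      rationalTateRepresentation (absoluteGaloisGroup ℚ) (geomPoints W) ℓ x.1 x.2)
    {v : HeightOneSpectrum (𝓞 ℚ)} (hv : (3 : 𝓞 ℚ) ∈ v.asIdeal)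
    {𝔓 : Ideal (absIntegers (𝓞 ℚ) ℚ)} (h𝔓 : 𝔓 ∈ v.primesAbove) :
    (rationalTateGaloisRepOf (geomPoints W) ℓ h).swanConductorAt (𝓞 ℚ) 𝔓 = 1 ∨
      (rationalTateGaloisRepOf (geomPoints W) ℓ h).swanConductorAt (𝓞 ℚ) 𝔓 = 3 := by
  rw [swanConductorAt_rationalTate_eq_condExp_sub_two_of_classO6 W ℓ hO6 hℓ h hv h𝔓]
  rcases (PSKodairaDictionary.condExp_eq_three_or_five_iff_odd W hO6.2.1 hO6.2.2).mpr hodd with h3 | h5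
  · left; rw [h3]; norm_num
  · right; rw [h5]; norm_num

end ClassO6

/-! ### §3 Wild elements at `3` and the mod-`9` cyclotomic character -/

/-- In `(ℤ/9)ˣ` an element killed by a power of `3` is killed by `3` (`#(ℤ/9)ˣ = 6`). [folklore] -/
theorem pow_three_eq_one_of_pow_three_pow_eq_one {x : (ZMod 9)ˣ} {t : ℕ} (h : x ^ 3 ^ t = 1) :
    x ^ 3 = 1 := by
  have h6 : x ^ 6 = 1 := by
    have hc : Fintype.card (ZMod 9)ˣ = 6 := by rw [ZMod.card_units_eq_totient]; decide
    rw [← hc]; exact pow_card_eq_one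
  have hd : orderOf x ∣ 3 ^ t := orderOf_dvd_of_pow_eq_one h
  have hd6 : orderOf x ∣ 2 * 3 := orderOf_dvd_of_pow_eq_one h6
  have hcop : (orderOf x).Coprime 2 :=
    (Nat.Coprime.pow_left t (by norm_num : Nat.Coprime 3 2)).coprime_dvd_left hd
  exact orderOf_dvd_iff_pow_eq_one.mp (hcop.dvd_of_dvd_mul_left hd6)

/-- The units mod `9` of order dividing `3` are the powers of `4`. [folklore] -/
theorem exists_coe_eq_four_pow {x : (ZMod 9)ˣ} (h : x ^ 3 = 1) : ∃ k : Fin 3, (x : ZMod 9) = 4 ^ (k : ℕ) := by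
  revert x
  decide

/-- **The cyclotomic character of a wild element is killed by a power of the residue characteristic.** For a
number field `K`, a prime `𝔓 ∣ v` of `\bar ℤ_K`, `u > 0` and `σ ∈ Γ_K^u(𝔓)`: `χ_N(σ)^{p^t} = 1` for some `t`,
`p = char(𝓞 K / v)`. Proof: on a finite Galois `E ∋ ζ_N` inside `K̄` the restriction of `σ` lies in
`Gal(E/K)^u ≤ G₁(𝔓 ∩ E)`, a `p`-group (`isPGroup_ramificationSubgroup_one_of_mem_primesAbove`), so `σ^{p^t}`
fixes `ζ_N`. [cite: SerreLocalFields1979, Ch. IV §2 Cor. 3 of Prop. 7 and §3 Remark 1] -/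
theorem exists_modNCyclotomicCharacter_pow_eq_one_of_mem_absUpperRamificationSubgroup
    {K : Type} [Field K] [NumberField K] (N : ℕ) [NeZero N] [NeZero ((N : ℕ) : K)]
    {v : HeightOneSpectrum (𝓞 K)} {𝔓 : Ideal (absIntegers (𝓞 K) K)} (h𝔓 : 𝔓 ∈ v.primesAbove)
    {u : ℝ} (hu : 0 < u) {σ : absoluteGaloisGroup K} (hσ : σ ∈ absUpperRamificationSubgroup (𝓞 K) 𝔓 u) :
    ∃ t : ℕ, modNCyclotomicCharacter K N σ ^ ringChar (𝓞 K ⧸ v.asIdeal) ^ t = 1 := by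
  classical
  -- a primitive `N`-th root of unity `ζ ∈ K̄` and a finite Galois `E ∋ ζ`
  obtain ⟨ζ, hζ⟩ := HasEnoughRootsOfUnity.exists_primitiveRoot (AlgebraicClosure K) N
  have hζint : IsIntegral K ζ :=
    IsIntegral.of_pow (Nat.pos_of_ne_zero (NeZero.ne N)) (by rw [hζ.pow_eq_one]; exact isIntegral_one)
  haveI : FiniteDimensional K K⟮ζ⟯ := IntermediateField.adjoin.finiteDimensional hζint
  let E : IntermediateField K (AlgebraicClosure K) := IntermediateField.normalClosure K K⟮ζ⟯ (AlgebraicClosure K)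
  haveI : FiniteDimensional K E := normalClosure.is_finiteDimensional K _ _
  haveI : Normal K E := normalClosure.normal K _ _
  haveI : Algebra.IsSeparable K E := Algebra.IsSeparable.of_integral K E
  haveI : IsGalois K E := ⟨⟩
  -- `σ|_E ∈ Gal(E/K)^u ≤ G₁`, a `p`-group
  have h1 := (mem_absUpperRamificationSubgroup_iff.mp hσ) E
  have h2 := upperRamificationSubgroup_le_ramificationSubgroup_one
    (𝔓.comap (E.integralClosureToAbsIntegers (𝓞 K))) (E ≃ₐ[K] E) hu h1
  have hG1 := isPGroup_ramificationSubgroup_one_of_mem_primesAbove h𝔓 E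
  obtain ⟨t, ht⟩ := hG1 ⟨_, h2⟩
  refine ⟨t, ?_⟩
  -- so `σ ^ p ^ t` restricts trivially to `E`, hence fixes `ζ`
  have hker : σ ^ ringChar (𝓞 K ⧸ v.asIdeal) ^ t ∈ (absRestrictNormalHom (K := K) E).ker := by
    rw [MonoidHom.mem_ker, map_pow]
    exact congrArg Subtype.val ht
  have hfixE : absoluteGaloisGroup.toAlgEquiv K (σ ^ ringChar (𝓞 K ⧸ v.asIdeal) ^ t) ∈ E.fixingSubgroup := by
    rw [← IntermediateField.restrictNormalHom_ker]
    exact hker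
  have hfix : σ ^ ringChar (𝓞 K ⧸ v.asIdeal) ^ t ∈
      (IntermediateField.fixingSubgroup K⟮ζ⟯ : Subgroup (absoluteGaloisGroup K)) :=
    IntermediateField.fixingSubgroup_antitone (IntermediateField.le_normalClosure _) hfixE
  have hχ := modNCyclotomicCharacter_eq_one_of_mem_fixingSubgroup K N hζ _ hfix
  rwa [map_pow] at hχ

/-- **A wild element at `3` has mod-`9` cyclotomic character of order dividing `3`**: for a prime `𝔓 ∣ 3` of
`ℤ̄`, `u > 0` and `σ ∈ Γ_ℚ^u(𝔓)`, `χ₉(σ)³ = 1`. [cite: SerreLocalFields1979, Ch. IV §2 Cor. 3 of Prop. 7] -/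
theorem modNCyclotomicCharacter_nine_pow_three_eq_one_of_mem_absUpperRamificationSubgroup
    {v : HeightOneSpectrum (𝓞 ℚ)} (hv : (3 : 𝓞 ℚ) ∈ v.asIdeal)
    {𝔓 : Ideal (absIntegers (𝓞 ℚ) ℚ)} (h𝔓 : 𝔓 ∈ v.primesAbove)
    {u : ℝ} (hu : 0 < u) {σ : absoluteGaloisGroup ℚ} (hσ : σ ∈ absUpperRamificationSubgroup (𝓞 ℚ) 𝔓 u) :
    modNCyclotomicCharacter ℚ 9 σ ^ 3 = 1 := by
  haveI : NeZero ((9 : ℕ) : ℚ) := ⟨by norm_num⟩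
  obtain ⟨t, ht⟩ := exists_modNCyclotomicCharacter_pow_eq_one_of_mem_absUpperRamificationSubgroup 9 h𝔓 hu hσ
  rw [ringChar_eq_three hv] at ht
  exact pow_three_eq_one_of_pow_three_pow_eq_one ht

/-- **A wild element at `3` has `χ₉ ∈ {1, 4, 7}`** (as a residue mod `9`).
[cite: SerreLocalFields1979, Ch. IV §2 Cor. 3 of Prop. 7] -/
theorem exists_coe_modNCyclotomicCharacter_nine_eq_four_pow_of_mem_absUpperRamificationSubgroup
    {v : HeightOneSpectrum (𝓞 ℚ)} (hv : (3 : 𝓞 ℚ) ∈ v.asIdeal)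
    {𝔓 : Ideal (absIntegers (𝓞 ℚ) ℚ)} (h𝔓 : 𝔓 ∈ v.primesAbove)
    {u : ℝ} (hu : 0 < u) {σ : absoluteGaloisGroup ℚ} (hσ : σ ∈ absUpperRamificationSubgroup (𝓞 ℚ) 𝔓 u) :
    ∃ k : Fin 3, (modNCyclotomicCharacter ℚ 9 σ : ZMod 9) = 4 ^ (k : ℕ) :=
  exists_coe_eq_four_pow
    (modNCyclotomicCharacter_nine_pow_three_eq_one_of_mem_absUpperRamificationSubgroup hv h𝔓 hu hσ)

/-! ### §4 The principal-series rows: `ρ_ℓ(τ)² ≠ 1` for every inertia generator `τ` (`χ₉(τ) = 2`) -/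

section PSRow

variable (W : WeierstrassCurve ℚ) [W.IsElliptic] [W.IsGloballyMinimal] (ℓ : ℕ) [Fact ℓ.Prime]

/-- On a principal-series row, an inertia element `i` at `3` with `χ₉(i)³ = 1` acts on `V_ℓ(W)` as a power of
`ρ(τ²)` for any `τ ∈ I_𝔓` with `χ₉(τ) = 2` (`χ₉(i) = 4^k = χ₉(τ^{2k})`, and `τ^{-2k} i` fixes `ζ₉`, hence acts
trivially by the lead's `InertiaOverCyclotomicNine`). [cite: SilvermanAEC2009, Prop. VII.4.1] -/
theorem rationalGaloisRepTate_eq_pow_sq_of_pow_three_eq_one (hO6 : ClassO6 W 3)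
    (hev : Even (padicValInt 3 W.minimalDiscriminantInt))
    (hsq : W.minimalDiscriminantInt / 3 ^ padicValInt 3 W.minimalDiscriminantInt % 3 = 1) (hℓ : ℓ ≠ 3)
    {v : HeightOneSpectrum (𝓞 ℚ)} (hv : (3 : 𝓞 ℚ) ∈ v.asIdeal)
    {𝔓 : Ideal (absIntegers (𝓞 ℚ) ℚ)} (h𝔓 : 𝔓 ∈ v.primesAbove)
    {τ : absoluteGaloisGroup ℚ} (hτ : τ ∈ 𝔓.inertia (absoluteGaloisGroup ℚ))
    (hχτ : (modNCyclotomicCharacter ℚ 9 τ : ZMod 9) = 2)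
    {i : absoluteGaloisGroup ℚ} (hi : i ∈ 𝔓.inertia (absoluteGaloisGroup ℚ))
    (hχi : modNCyclotomicCharacter ℚ 9 i ^ 3 = 1) :
    ∃ k : ℕ, W.rationalGaloisRepTate ℓ i = (W.rationalGaloisRepTate ℓ τ ^ 2) ^ k := by
  obtain ⟨k, hk⟩ := exists_coe_eq_four_pow hχi
  refine ⟨k, ?_⟩
  -- `h := (τ ^ (2k))⁻¹ * i` lies in `I_𝔓` and fixes `ζ₉`
  set h : absoluteGaloisGroup ℚ := (τ ^ (2 * (k : ℕ)))⁻¹ * i with hh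
  have hhI : h ∈ 𝔓.inertia (absoluteGaloisGroup ℚ) :=
    Subgroup.mul_mem _ (Subgroup.inv_mem _ (Subgroup.pow_mem _ hτ _)) hi
  have hχh : modNCyclotomicCharacter ℚ 9 h = 1 := by
    apply Units.ext
    have h1 : ((modNCyclotomicCharacter ℚ 9 (τ ^ (2 * (k : ℕ))) : (ZMod 9)ˣ) : ZMod 9) = 4 ^ (k : ℕ) := by
      rw [map_pow, Units.val_pow_eq_pow_val, hχτ, pow_mul]
      norm_num
    rw [hh, map_mul, map_inv, Units.val_mul, Units.val_one, hk, ← h1, Units.inv_mul]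
  have htriv : W.rationalGaloisRepTate ℓ h = 1 := LinearMap.ext fun x =>
    rationalGaloisRepTate_apply_eq_self_of_mem_inertia_of_modNCyclotomicCharacter_eq_one W hO6 hev hsq ℓ
      hℓ hv h𝔓 hhI hχh x
  have hi_eq : i = τ ^ (2 * (k : ℕ)) * h := by rw [hh, mul_inv_cancel_left]
  rw [hi_eq, map_mul, htriv, mul_one, map_pow, pow_mul]

/-- **On a principal-series row `ρ_ℓ(τ)² ≠ 1` for every `τ ∈ I_𝔓` with `χ₉(τ) = 2`** (`ℓ ≠ 3`; the Swan-conductor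
road to Galois wildness at `3`): otherwise every wild element `σ ∈ Γ_ℚ^u(𝔓)`, `u > 0` (in `I_𝔓`, `χ₉(σ)³ = 1`
by §3) acts as a power of `ρ(τ)² = 1`, so `V_ℓ W` is tame at `𝔓` — against `Sw_𝔓(V_ℓ W) = f₃ − 2 ≥ 1` (§1,
Ogg's formula at `3`). Independent of cycu-p5's `InertiaWildAtThreeUnconditional` (Néron–Ogg–Shafarevich over
`ℚ(ζ₃)`). [cite: SilvermanATAEC1994, Thm. IV.11.1 (p = 3)] [cite: SerreLocalFields1979, Ch. IV §2 Cor. 3] -/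
theorem rationalGaloisRepTate_sq_ne_one_of_psRow (hO6 : ClassO6 W 3)
    (hev : Even (padicValInt 3 W.minimalDiscriminantInt))
    (hsq : W.minimalDiscriminantInt / 3 ^ padicValInt 3 W.minimalDiscriminantInt % 3 = 1) (hℓ : ℓ ≠ 3)
    {v : HeightOneSpectrum (𝓞 ℚ)} (hv : (3 : 𝓞 ℚ) ∈ v.asIdeal)
    {𝔓 : Ideal (absIntegers (𝓞 ℚ) ℚ)} (h𝔓 : 𝔓 ∈ v.primesAbove)
    {τ : absoluteGaloisGroup ℚ} (hτ : τ ∈ 𝔓.inertia (absoluteGaloisGroup ℚ))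
    (hχτ : (modNCyclotomicCharacter ℚ 9 τ : ZMod 9) = 2) :
    W.rationalGaloisRepTate ℓ τ ^ 2 ≠ 1 := by
  intro h1
  have h := W.continuous_rationalGaloisRepTate_holds ℓ
  apply not_isTameAt_rationalTate_of_classO6 W ℓ hO6 hℓ h hv h𝔓
  intro u hu σ hσ
  have hσI : σ ∈ 𝔓.inertia (absoluteGaloisGroup ℚ) :=
    absUpperRamificationSubgroup_le_inertia_holds (𝓞 ℚ) 𝔓 u hσ
  obtain ⟨k, hk⟩ := rationalGaloisRepTate_eq_pow_sq_of_pow_three_eq_one W ℓ hO6 hev hsq hℓ hv h𝔓 hτ hχτ hσI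
    (modNCyclotomicCharacter_nine_pow_three_eq_one_of_mem_absUpperRamificationSubgroup hv h𝔓 hu hσ)
  change W.rationalGaloisRepTate ℓ σ = 1
  rw [hk, h1, one_pow]

/-- **`ρ_ℓ(τ²) ≠ 1` while `χ₉(τ²) = 4`** — the content of the registered stub `stub_WILD` (skeletons v7 of K1/K2)
for every `ℓ ≠ 3` and EVERY inertia generator `τ` (`χ₉(τ) = 2`), by the Swan-conductor road; the stub itself is
cycu-p5's `InertiaWildAtThreeUnconditional.stub_WILD_unconditional` and is not re-declared here.
[cite: SilvermanATAEC1994, Thm. IV.11.1 (p = 3)] -/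
theorem modNCyclotomicCharacter_sq_eq_four_and_rationalGaloisRepTate_sq_ne_one_of_psRow (hO6 : ClassO6 W 3)
    (hev : Even (padicValInt 3 W.minimalDiscriminantInt))
    (hsq : W.minimalDiscriminantInt / 3 ^ padicValInt 3 W.minimalDiscriminantInt % 3 = 1) (hℓ : ℓ ≠ 3)
    {v : HeightOneSpectrum (𝓞 ℚ)} (hv : (3 : 𝓞 ℚ) ∈ v.asIdeal)
    {𝔓 : Ideal (absIntegers (𝓞 ℚ) ℚ)} (h𝔓 : 𝔓 ∈ v.primesAbove)
    {τ : absoluteGaloisGroup ℚ} (hτ : τ ∈ 𝔓.inertia (absoluteGaloisGroup ℚ))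
    (hχτ : (modNCyclotomicCharacter ℚ 9 τ : ZMod 9) = 2) :
    τ ^ 2 ∈ 𝔓.inertia (absoluteGaloisGroup ℚ) ∧
      (modNCyclotomicCharacter ℚ 9 (τ ^ 2) : ZMod 9) = 4 ∧ W.rationalGaloisRepTate ℓ (τ ^ 2) ≠ 1 := by
  refine ⟨Subgroup.pow_mem _ hτ 2, ?_, ?_⟩
  · rw [map_pow, Units.val_pow_eq_pow_val, hχτ]; norm_num
  · rw [map_pow]
    exact rationalGaloisRepTate_sq_ne_one_of_psRow W ℓ hO6 hev hsq hℓ hv h𝔓 hτ hχτ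

end PSRow

end Summit.BirchSwinnertonDyer.BirchSwinnertonDyer.Theorems.SwanConductorAtThree

end
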